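import Mathlib
import Summits.NavierStokesRegularity.NavierStokesRegularity.Theorems.FilamentSkeletonRssAnalyticStripLiaSymbolSeriesDefs

/-!
# Clause 13-J/13-R band window (`Φ′ = 2C − E ≥ 9/100`), KERNEL-ONLY re-certification — DEFINITIONS (cell checker + node list)

Hand leafhand-ns-filamentskeletonrs-7 g1 (prover), 2026-08-31, `--supports stmt-NavierStokesRegularity-23612 --as helper`; by-product of the
kernel-only `LiaSymbolBound` machinery (`…AnalyticStripLiaSymbolSeriesDefs/Sound/Encl/Window`, landed for 23320's stub P3).  The band window of
record `…Clause13LiaSymbolDerivWindow.deriv_liaSym_ge_band` (`𝔖′ ≥ 9x/200` on `x ∈ [17/20, 363/100]`, design n1b of the model gluing) rests on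
`native_decide`; the companion `…Clause13LiaSymbolDerivWindowKernel` proves the WIDER window `x ∈ [41/50, 73/20]` (`p ∈ [1/6, 67/20]`) with standard
axioms.  Statement-only file: one `p`-cell `[a,b]` passes iff `φ₀ ≤ 2·CLo(b) − EHi(a)` (`C`, `E` antitone; exact-ℚ enclosures of `…SeriesDefs`).
HONEST FRAMING: certified numerics for one explicit real integral, serving a HYPOTHETICAL filament-skeleton line on the NEGATIVE side of a
MODEL route; nothing here bears on Navier–Stokes regularity or blow-up.
-/

set_option linter.dupNamespace false

namespace Summit.NavierStokesRegularity.NavierStokesRegularity.Theorems.AnalyticStripLiaSymbol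

namespace Series

/-- One band-window `p`-cell `[a, b]`: admissible nodes and `φ₀ ≤ 2·CLo(b) − EHi(a)`. -/
def cellChkDer (φ₀ : ℚ) (a : ℚ) (ka : ℤ) (b : ℚ) (kb : ℤ) : Bool :=
  decide (0 < a) && decide (a ≤ b) && logOK a ka && logOK b kb &&
    decide (φ₀ ≤ 2 * CLo b kb - EHi a ka)

/-- Chain the band-window cell checks over consecutive nodes. -/
def cellsChkDer (φ₀ : ℚ) : List (ℚ × ℤ) → Bool
  | x :: y :: rest => cellChkDer φ₀ x.1 x.2 y.1 y.2 && cellsChkDer φ₀ (y :: rest)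
  | _ => true

/-- The node list `(p, k)` for `p ∈ [1/6, 67/20]` (8 nodes suffice: the true margin of `2C − E` over `9/100` is large except at the top). -/
def nodesDer : List (ℚ × ℤ) :=
  [((1 : ℚ) / 6, -3), ((51 : ℚ) / 200, -2), ((9 : ℚ) / 20, -1), ((87 : ℚ) / 100, 0), ((159 : ℚ) / 100, 1), ((123 : ℚ) / 50, 1), ((313 : ℚ) / 100, 2), ((67 : ℚ) / 20, 2)]

end Series

end Summit.NavierStokesRegularity.NavierStokesRegularity.Theorems.AnalyticStripLiaSymbol
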